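import Summits.ResolutionOfSingularities.ResolutionOfSingularities.Theorems.FrobeniusClosingSteerSigmaTopLegalityConeDivisor
import Summits.ResolutionOfSingularities.ResolutionOfSingularities.Theorems.FrobeniusClosingSteerMemberDerivations
import Summits.ResolutionOfSingularities.ResolutionOfSingularities.Theorems.FrobeniusClosingSteerCleaningExact
import Literature.AlgebraicGeometry.Resolution.QuadraticTransforms
import Literature.AlgebraicGeometry.Resolution.ExcellentRings
import HarnessLib

/-!
# Crux `Steer` (stmt-ResolutionOfSingularities-16345), chain W4.1: hNT4 — NO TANGENTIAL STEP for isolated `2`-radicands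
# over `4`-dimensional regular local rings with PERFECT residue fields, part 1: the word and the LAST STEP of the assembly
# (res-L0-w41-plan-1 RULINGs 116b/117a/120c; spec = res-L0-w41-idea-3's `HNT4-BLUEPRINT.md`; Theses-free)

OURS (campaign `res-hironaka`, rung L ★L-G4, slot W4.1; statements about the route's own objects; NOT statements of the
manuscript under review [claim: Hironaka2017, status: under-review]; AI review is weaker than expert review). Seat
res-D-pv-004 (AS res-L0-w41-stub-10) = the hNT4 ASSEMBLER; target `∀ e, 2 ≤ e → NoTangentialStepPerfect 2 4 (2*e)` (the WORK
binder `hNT4` of `eternalSteeredRunTwo_of_slate11'`, r38).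

* `NoTangentialStepPerfect p c d` — res-L0-w41-idea-3's word (`Sketch-g5.lean` §2, 8f1a85be7bf4e5c8) VERBATIM, as pasted into
  the route file by res-L0-w41-strat-2's §σ2.28 (e0): under the binders of G-perf(c, d) — a chain `S : ℕ → Subring L` of
  EXCELLENT REGULAR LOCAL rings of dimension `c` in characteristic `p`, consecutive QUADRATIC TRANSFORMS with exceptional
  parameters `x m`, radicands `f m` obeying the law `f (m+1)·(x m)^d = f m − (g m)^p`, cleaned (`hmult`) and OPTIMALLY so
  (`hopt`), with cleaning derivations, PERFECT residue fields and ISOLATED radicand rings — every step is TRANSVERSAL to the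
  previous exceptional divisor: `(x m) = (x (m+1))` as ideals of `S (m+2)`.
* `noTangentialStepPerfect_two_four_of_binaryConeNormalForm` — STAGE 1 of the assembly = its LAST STEP (blueprint §0 / §2
  step 8): if a tangential step forces, at some stage `k`, the BINARY-CONE NORMAL FORM `f (k+1) = h² + x_k·A + σ·τ·H₀²` with
  `H₀ ∈ 𝔪_(k+1)` (one named hypothesis `hBCNF` on the word's binders VERBATIM — the content of the bricks T1/T2/T3/C5/N/L/C6
  of the blueprint, discharged in the sequel files), then `NoTangentialStepPerfect 2 4 (2e)` for every `e ≥ 2`. Bricks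
  consumed BY NAME: A2 `CleaningOptimal.excParam_mem_and_not_mem_sq` (res-D-pv-011: `x k ∈ 𝔪_(k+1) ∖ 𝔪_(k+1)²`), A1
  `CleaningOptimal.sub_pow_mem_pow_of_law` (the cleaned order `2e` at `k+1`), D
  `SigmaTopLegality.not_hasIsolatedSingularity_of_binaryCone'` (res-L0-w41-idea-3, p529051: a binary cone over a
  `4`-dimensional regular local ring is not an isolated `2`-radicand).

No Theses file is imported; nothing here is a route item or a registration. [folklore]
-/

noncomputable section

set_option linter.dupNamespace false

open Polynomial IsLocalRing

namespace Summit.ResolutionOfSingularities.ResolutionOfSingularities.Theorems.SwitchingDichotomy.NoTangentialStep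

open Literature.AlgebraicGeometry.Resolution
open Summit.ResolutionOfSingularities.ResolutionOfSingularities.Theorems.SwitchingDichotomy.SigmaTopLegality
open Summit.ResolutionOfSingularities.ResolutionOfSingularities.Theorems.SwitchingDichotomy.MemberDerivations

/-! ## The word (VERBATIM res-L0-w41-idea-3 `Sketch-g5.lean` §2 = res-L0-w41-strat-2 §σ2.28 (e0)) -/

/-- **NoTangentialStepPerfect(c, d)** (idea-3 GEN 5, the LEVER): under the binders of G-perf(c, d), EVERY step is
TRANSVERSAL to the previous exceptional divisor: the exceptional parameter `x m` of `S m ≤ S (m+1)` still generates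
`𝔪_(m+1)·S (m+2) = (x (m+1))`, i.e. `(x m) = (x (m+1))` as ideals of `S (m+2)` (the centre of `S (m+2)` is NOT on the
strict transform `Ẽ_(m+1)` of `E_(m+1) = V(x m)`). Mechanism (card-5 addendum GEN 5, Lemma B + §1 (D)): a tangential
step forces the restricted radicand on the newest divisor to be a BINARY even-degree form mod squares, and then the
stage is not isolated when `c ≥ 4` (`(D″)`); at `c = 3` the form is unary, hence a square (card 5 (L2)). Why it might
fail: non-rational centres need the geometric-branch device (completion + Cohen coefficient field + base change to the
algebraic closure; perfectness makes optimality / isolatedness / tangency geometric). OURS. [folklore] -/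
def NoTangentialStepPerfect (p c d : ℕ) : Prop :=
  ∀ (L : Type) [Field L] [CharP L p] (S : ℕ → Subring L) [∀ m, IsLocalRing (S m)]
    (hle : ∀ m, S m ≤ S (m + 1)) (f g : ∀ m, S m) (x : ∀ m, S (m + 1)),
    (∀ m, IsRegularLocalRing (S m)) → (∀ m, IsExcellentRing (S m)) → (∀ m, ringKrullDim (S m) = c) →
    (∀ m, IsQuadraticTransform (S m) (S (m + 1))) →
    (∀ m, Ideal.span ((fun y : S m => (⟨(y : L), hle m y.2⟩ : S (m + 1))) '' (maximalIdeal (S m) : Set (S m)))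
        = Ideal.span {x m}) →
    (∀ m, ((f (m + 1) : S (m + 1)) : L) * ((x m : S (m + 1)) : L) ^ d =
        ((f m : S m) : L) - ((g m : S m) : L) ^ p) →
    (∀ m, ∃ h : S m, f m - h ^ p ∈ maximalIdeal (S m) ^ p) →
    (∀ m (h : S m), f m - h ^ p ∉ maximalIdeal (S m) ^ (d + 1)) →
    (∀ m, HasCleaningDerivations p (S m) (f m) (g m)) →
    (∀ m, PerfectField (IsLocalRing.ResidueField (S m))) →
    (∀ m, HasIsolatedSingularity (RadicandRing (S m) p (f m))) →
    ∀ m, Ideal.span {(⟨((x m : S (m + 1)) : L), hle (m + 1) (x m).2⟩ : S (m + 2))} = Ideal.span {x (m + 1)}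


/-! ## STAGE 1 — the assembly's LAST STEP: a binary-cone normal form at a tangential step contradicts isolatedness

Blueprint §0/§2 step 8 (brick D = `SigmaTopLegality.not_hasIsolatedSingularity_of_binaryCone'`, p529051), fed by A1
(`CleaningOptimal.sub_pow_mem_pow_of_law`, the cleaned order at `m+1`) and A2's first half
(`CleaningOptimal.excParam_mem_and_not_mem_sq`: `x m ∈ 𝔪_(m+1) ∖ 𝔪_(m+1)²`). The remaining bricks (T1 chart identification,
T2 cone-of-a-square, TV4/C5 vertex bridge + tangential restriction, N even binary forms in characteristic 2, L the lift to
`S (m+1)`) are bundled in ONE named hypothesis `hBCNF` — «at a TANGENTIAL step the radicand `f (m+1)` has the BINARY-CONE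
NORMAL FORM `h² + x_m·A + σ·τ·H₀²` with `H₀ ∈ 𝔪_(m+1)`» — stated on the binders of the word VERBATIM; STAGE 2 discharges it. -/

/-- **hNT4, STAGE 1** (res-L0-w41-plan-1 RULING 116b/117a; res-L0-w41-idea-3 `HNT4-BLUEPRINT.md` §0, step 8): if at every
TANGENTIAL step (`(x m) ≠ (x (m+1))` in `S (m+2)`) of a G-perf(4, 2e) chain in characteristic `2` the radicand `f (m+1)`
forces, at SOME stage `k` (the blueprint's main line: `k = m`; its C6 branch: `k = m+1`), the binary-cone normal form
`f (k+1) = h² + x_k·A + σ·τ·H₀²` with `H₀ ∈ 𝔪_(k+1)` (hypothesis `hBCNF`, the word's binders VERBATIM), then `NoTangentialStepPerfect 2 4 (2e)` holds for `e ≥ 2`: by `CleaningOptimal.excParam_mem_and_not_mem_sq`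
the exceptional parameter `x k` is a regular parameter of `S (k+1)`, by `CleaningOptimal.sub_pow_mem_pow_of_law` at `k+1`
the radicand `f (k+1)` is a square modulo `𝔪_(k+1)^(2e) ≤ 𝔪_(k+1)²`, and then
`SigmaTopLegality.not_hasIsolatedSingularity_of_binaryCone'` (dimension `4`) contradicts the isolatedness binder at `k+1`.
OURS. [folklore] -/
theorem noTangentialStepPerfect_two_four_of_binaryConeNormalForm (e : ℕ) (he : 2 ≤ e)
    (hBCNF : ∀ (L : Type) [Field L] [CharP L 2] (S : ℕ → Subring L) [∀ m, IsLocalRing (S m)]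
      (hle : ∀ m, S m ≤ S (m + 1)) (f g : ∀ m, S m) (x : ∀ m, S (m + 1)),
      (∀ m, IsRegularLocalRing (S m)) → (∀ m, IsExcellentRing (S m)) → (∀ m, ringKrullDim (S m) = (4 : ℕ)) →
      (∀ m, IsQuadraticTransform (S m) (S (m + 1))) →
      (∀ m, Ideal.span ((fun y : S m => (⟨(y : L), hle m y.2⟩ : S (m + 1))) '' (maximalIdeal (S m) : Set (S m)))
          = Ideal.span {x m}) →
      (∀ m, ((f (m + 1) : S (m + 1)) : L) * ((x m : S (m + 1)) : L) ^ (2 * e) =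
          ((f m : S m) : L) - ((g m : S m) : L) ^ 2) →
      (∀ m, ∃ h : S m, f m - h ^ 2 ∈ maximalIdeal (S m) ^ 2) →
      (∀ m (h : S m), f m - h ^ 2 ∉ maximalIdeal (S m) ^ (2 * e + 1)) →
      (∀ m, HasCleaningDerivations 2 (S m) (f m) (g m)) →
      (∀ m, PerfectField (IsLocalRing.ResidueField (S m))) →
      (∀ m, HasIsolatedSingularity (RadicandRing (S m) 2 (f m))) →
      ∀ m, Ideal.span {(⟨((x m : S (m + 1)) : L), hle (m + 1) (x m).2⟩ : S (m + 2))} ≠ Ideal.span {x (m + 1)} →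
        ∃ (k : ℕ) (h A σ τ H₀ : S (k + 1)),
          f (k + 1) = h ^ 2 + x k * A + σ * τ * H₀ ^ 2 ∧ H₀ ∈ maximalIdeal (S (k + 1))) :
    NoTangentialStepPerfect 2 4 (2 * e) := by
  intro L _ _ S _ hle f g x hreg hexc hdim hqt hx hlaw hmult hopt hH hperf hiso m
  by_contra htan
  obtain ⟨k, h, A, σ, τ, H₀, hf, hH₀⟩ :=
    hBCNF L S hle f g x hreg hexc hdim hqt hx hlaw hmult hopt hH hperf hiso m htan
  haveI := hreg (k + 1)
  -- A2 (first half): the exceptional parameter `x k` is a regular parameter of `S (k+1)`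
  obtain ⟨hx1, hx2⟩ :=
    CleaningOptimal.excParam_mem_and_not_mem_sq (hreg k) (hreg (k + 1)) (hqt k) (hle k) (x k) (hx k)
  -- A1 at `k+1`: the radicand `f (k+1)` is a square modulo `𝔪^(2e) ≤ 𝔪²`
  have hmult' : ∃ g' : S (k + 1), f (k + 1) - g' ^ 2 ∈ maximalIdeal (S (k + 1)) ^ 2 := by
    refine ⟨g (k + 1), Ideal.pow_le_pow_right (n := 2 * e) (by omega) ?_⟩
    exact CleaningOptimal.sub_pow_mem_pow_of_law 2 (hreg (k + 1)) (hqt (k + 1)) (hle (k + 1)) (f (k + 1))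
      (g (k + 1)) (f (k + 2)) (x (k + 1)) e (hx (k + 1)) (hlaw (k + 1))
  -- D: the binary-cone normal form makes the stage `k+1` non-isolated
  exact not_hasIsolatedSingularity_of_binaryCone' (S (k + 1)) (f (k + 1)) h (x k) A σ τ H₀ hf hx1 hx2 hH₀ hmult'
    le_rfl (hdim (k + 1)) (hiso (k + 1))

end Summit.ResolutionOfSingularities.ResolutionOfSingularities.Theorems.SwitchingDichotomy.NoTangentialStep

end
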